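import Summits.QuantumFields.YangMills.Theorems.BalabanUVNodesPortS1FEStepUc
import Summits.QuantumFields.YangMills.Theorems.BalabanUVNodesPortS1LZdetGermMem

/-!
# BalabanUVNodes — port (S1): THE ε₀-REGULAR-CLASS EDITION OF THE FE INDUCTIVE STEP (★★★ director-ym g24 №615 (1)(b) «DOMAIN KIND (ε₀)», ◇ lens-1 g14 (T-A2)′, ◆ CRIT-1 g39 (C3)): rows (a)(b) on
  `U^c_{k+1}(X, α₀, α₁)` as before, the (1.7) identity on the chart-preimage of PRINT's OWN DOMAIN `U_{k+1}(ε₀)` — `{B : U_{k+1}(W_B) ∈ bgReg … (k+1) ε₀}` (|∂U − 1| < ε₀ξ², [I] (1.2) p.260; Thm 3 is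
  STATED there, p.264) — with `ε₀ > 0` chosen k-uniformly with the other constants; letters `FEStepReg`, `PortRecordLZHalfReg`; the germ edition ✓`PortRecordFEHalfBox` from the two, the near-`0`
  class membership being a THEOREM from the antecedent's `hP9` (porter hand `hand-27930-FE-1` g0, cell `ym-nodeO-ideate`)

`--supports stmt-QuantumFields-27930` (helper; NO `--workitem`); count-neutral.  [I] = [Balaban1987RG1]; [15] = [Balaban1985Variational].

WHY (№615 (1)(b), two reasons on the record): with the identity's domain = the ε₀-regular class, (i) step-stability is FREE — the stub's own antecedent `VariationalThm1RegSepCoP7MGB F 2 …` is [15]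
Thm 1 (7) «minimal configurations satisfy |∂U_j − 1| < ε₀ξ²», and `bgReg` is monotone along the scales — and (ii) FE-2's inductive hypothesis IS the one print inducts on (Thm 3 lives on `U_k(ε₀)`);
the (α′)-kind (◆ (C3): primed radii for the identity's real domain inside `U^c(α₀, α₁)`) would re-run [15] Prop. 9 at every level inside the proof.  The NESTING «`bgReg … ε₀ ⇒ CutsInUc … α₀ α₁` for
`ε₀ ≤ ε₀(α₀, α₁)`» ([I] p.263 L5–20; [15] Prop. 9 — an axial-gauge smallness construction on each domain `X`) is what the FE-2 PROVER uses to know the pieces are analytic where the identity is claimed;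
it is NOT needed by the bookkeeping below and is NOT claimed here (M-sized brick, located).
* §1 `InRegClass F Mc k ε₀ a₀ ε₂₉ n B := UkExists … θ.εbg (W_B) ∧ recordBgField … B ∈ bgReg F 2 K (k+1) ε₀` (print's (1.1) existence clause — ◆ CRIT-1 g40's repair of the selector-junk inhabitant:
  without it every `W_B` with NO minimiser would sit in the class through `UkSel`'s default `1` — AND the charted datum's background `U_{k+1}(W_B)` ε₀-regular at its own scale `ξ = η_{k+1}`);
  ★ `IntFormula.RepresentsOnRegW … ε₀` ((f′) at every such `B`); ★ `IntLocalFormula.ResidueOnRegAtW … α₀ α₁ ε₀ E₀ κ Φf` (six rows at `(α₀, α₁)` ∧ (f′)-Reg at `ε₀`); `residueAtW_of_onReg` (⟹ germ given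
  `∀ᶠ B in 𝓝 0, InRegClass … B`); `representsOnRegW_of_onUc_of_nesting` (the Uc edition implies this one GIVEN the nesting, stated as a hypothesis — the located M brick's interface).
* §2 `LZResidueRegAt`, `FEResidueRegBoxAt`; ★★ `FEStepReg F` (✓`FEStepBox`'s frame; `∃ γ₀ E₂ κ α₀ α₁ ε₀` k-uniform after the LZ package `(E₁ κ₁ β₀ β₁ δ₀)`); `PortRecordLZHalfReg F`.  OPEN letters.
* §3 ★★ `eventually_inRegClass` — near `B = 0`, `W_B` has a minimiser (the antecedent's [15] Thm 1 token `PlaqSmall ε₁ V → UkExists ∧ UniqueUkOrbit` at one `ε₁ > 0` + ✓`eventually_plaqSmall_unitField`)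
  and `U_{k+1}(W_B) ∈ bgReg … (k+1) ε₀` for every `ε₀ > 0` (the plaquette variables tend to `1`: ✓`eventually_norm_plaq_recordBgUnits_sub_one_lt` from `hP9`, read back on `dist1 ∘ plaqHol` through `ιSU`); ★★★ `portRecordFEHalfBox_of_reg : (∀ F, PortRecordLZHalfReg F) → (∀ F, FEStepReg F) → ∀ F, PortRecordFEHalfBox F` — the ε₀-menu for
  `stub_FE`∕`stub_FEstep` (via ✓`feStepBox_of_feHalfBox`) is TWO letters.
(Q-ord) as ✓`FEStepBox`∕✓`FEStepUc`: `Mth` outermost, antecedent verbatim, `ε₂₉` first, LZ package, then `γ₀ E₂ κ α₀ α₁ ε₀` before `∀ k` (print: ε₀, α₀, α₁ depend on M; γ last).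
DEDUP: `InRegClass`, `IntFormula.RepresentsOnRegW`, `IntLocalFormula.ResidueOnRegAtW`, `representsW_of_onReg`, `residueAtW_of_onReg`, `representsOnRegW_of_onUc_of_nesting`, `LZResidueRegAt`, `FEResidueRegBoxAt`,
`FEStepReg`, `PortRecordLZHalfReg`, `feResidueRegBoxAt_all_of_step`, `feResidueBoxAt_of_reg`, `dist1_plaqHol_recordBgField_eq`, `eventually_inRegClass`, `portRecordFEHalfBox_of_reg` — 0 tree hits (`rg -ow`).

HONEST STATUS.  Names for the ε₀-class currency, TWO candidate letters (OPEN, inhabited nowhere: `FEStepReg` XXL, `PortRecordLZHalfReg` — NOT derivable from the landed LZ files without the P0 letter's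
(P2) row widened to the class, P0-class, located) and kernel bookkeeping incl. one continuity theorem; NOTHING of Bałaban's (2.10)–(2.14), §3–§5 or [II] asserted, ported, discharged or refuted;
`stub_FEstep` ∕ `stub_P0C` OPEN; ⟨27930⟩ OPEN (1∕3); NODE O 0∕1; COUNT 8∕28 · K 1∕4 UNMOVED; finite 𝕋⁴_{L^K} at fixed ε — NOT continuum ∕ OS ∕ Clay; **the Yang–Mills mass gap (Clay) is NOT proved by
any of this.**  No `sorry`, `instance`, `notation`; standard axioms.

References: T. Bałaban, *Renormalization group approach to lattice gauge field theories. I*, Comm. Math. Phys. 109 (1987) 249–301 [Balaban1987RG1] — (1.1)–(1.2) p.260, (1.7) p.261, p.263 L5–27,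
(1.18) p.263, Thm 3 p.264, p.268 L27–31; T. Bałaban, Comm. Math. Phys. 102 (1985) 277–309 [Balaban1985Variational] — Thm 1 (7) p.279, Prop. 9 p.309.
-/

noncomputable section

open scoped BigOperators Matrix.Norms.L2Operator Topology

namespace Summit.QuantumFields.YangMills.Theorems.K0RecordFormatNames

open Literature.MathematicalPhysics.QuantumFieldTheory.Balaban1983to89
open Literature.MathematicalPhysics.QuantumFieldTheory.Balaban1983to89.Node00
open Literature.MathematicalPhysics.QuantumFieldTheory.Balaban1983to89.T4Continuum (T4Family)
open _root_.Filter

variable (F : T4Family)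

/-! ## §1  The ε₀-regular class of the charted datum; (f′) on it; the residue; to the germ -/

/-- **`InRegClass F Mc k ε₀ a₀ ε₂₉ n B` — THE CHARTED DATUM HAS A GENUINE ε₀-REGULAR MINIMISER**: print's existence clause (1.1) — the level-`(k+1)` problem over `W_B` IS SOLVABLE at the record's
radius `θ.εbg = a₀` (so the rooted selector's value is a minimiser, not its junk default `1`; ◆ CRIT-1 g40's located J1′ row and repair) — AND the rooted background `U_{k+1}(W_B)` lies in print's class
`U_{k+1}(ε₀)` = `bgReg … (k+1) ε₀` (`|U(∂p) − 1| < ε₀ξ²`, `ξ = η_{k+1}`; the current clause of (1.2) is the tree's D-defB-1 divergence, not included).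
[cite: Balaban1987RG1, (1.1)–(1.2) p.260, p.264 (Thm 3 «defined on the spaces U_k(ε₀)»)] -/
def InRegClass (Mc k : ℕ) (ε₀ a₀ ε₂₉ : ℝ) (n : ℕ) (B : recordW F a₀ ε₂₉ k (recordK₀ F Mc k + n)) : Prop :=
  UkExists F 2 (recordK₀ F Mc k + n) (k + 1) (thetaFill F a₀ ε₂₉).εbg (unitField F (thetaFill F a₀ ε₂₉) k (recordK₀ F Mc k + n) B) ∧
    recordBgField F (thetaFill F a₀ ε₂₉) k (recordK₀ F Mc k + n) B ∈ bgReg F 2 (recordK₀ F Mc k + n) (k + 1) ε₀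

open scoped Classical in
/-- ★ **(f′)-Reg — THE WRAP-AWARE PAIR IDENTITY ON THE ε₀-REGULAR CLASS** (✓`IntFormula.RepresentsW` with «eventually at `B = 0`» replaced by «at every `B` with `InRegClass … ε₀ … B`»): print's (1.7) on
print's `U_k(ε₀)`. [cite: Balaban1987RG1, (1.7) p.261, (1.1)–(1.2) p.260] -/
def IntFormula.RepresentsOnRegW (Ψ : IntFormula) (a₀ ε₂₉ : ℝ) (Mc k : ℕ) (ε₀ : ℝ) (Ew : TorusPieces F Mc k)
    (Φf : (n : ℕ) → recordW F a₀ ε₂₉ k (recordK₀ F Mc k + n) → ℂ) : Prop :=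
  ∀ n (B : recordW F a₀ ε₂₉ k (recordK₀ F Mc k + n)), InRegClass F Mc k ε₀ a₀ ε₂₉ n B →
    Φf n B = ∑ X : (recordDomSys F Mc k (recordK₀ F Mc k + n)).Dom,
      (if X ∈ recordWrapCtr F Mc k (recordK₀ F Mc k + n) then
        Ew n X (pairCutTorusAt F a₀ ε₂₉ Mc k (recordK₀ F Mc k + n) X B)
      else Ψ (intCubes F Mc k (recordK₀ F Mc k + n) X) (pairCutAt F a₀ ε₂₉ Mc k (recordK₀ F Mc k + n) X B))

/-- ★ **THE WRAP-AWARE RESIDUE, ε₀-CLASS EDITION**: the six functional-free rows of ✓`ResidueAtW` at `(α₀, α₁)` ∧ (f′)-Reg at `ε₀`. [cite: Balaban1987RG1, (1.7) p.261, (1.18)–(1.19) p.263, (1.2) p.260] -/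
def IntLocalFormula.ResidueOnRegAtW (Mc k : ℕ) (Ψ : IntLocalFormula (F.L ^ (k + 1) * Mc)) (Ew : TorusPieces F Mc k) (a₀ ε₂₉ α₀ α₁ ε₀ E₀ κ : ℝ)
    (Φf : (n : ℕ) → recordW F a₀ ε₂₉ k (recordK₀ F Mc k + n) → ℂ) : Prop :=
  Ψ.Ψ.AnalyticOnUcOff F Mc k α₀ α₁ ∧ Ψ.Ψ.Bound118OnUcOff F Mc k α₀ α₁ E₀ κ ∧
    Ew.AnalyticOnW F α₀ α₁ ∧ Ew.Bound118OnW F α₀ α₁ E₀ κ ∧ Ew.LocalOnW F ∧ Ew.GaugeInvOnW F ∧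
    Ψ.Ψ.RepresentsOnRegW F a₀ ε₂₉ Mc k ε₀ Ew Φf

variable {F} in
/-- **(f′)-Reg ⟹ (f′)-W (germ)** whenever the charted data near `B = 0` are ε₀-regular. [cite: Balaban1987RG1, (1.7) p.261 (bookkeeping)] -/
theorem representsW_of_onReg {Ψ : IntFormula} {a₀ ε₂₉ : ℝ} {Mc k : ℕ} {ε₀ : ℝ} {Ew : TorusPieces F Mc k}
    {Φf : (n : ℕ) → recordW F a₀ ε₂₉ k (recordK₀ F Mc k + n) → ℂ}
    (h : Ψ.RepresentsOnRegW F a₀ ε₂₉ Mc k ε₀ Ew Φf)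
    (hnear : ∀ n, letI θ := thetaFill F a₀ ε₂₉; letI := θ.instVβ₁; letI := θ.instVβ₂; letI := θ.instιβ
      ∀ᶠ B in 𝓝 (0 : recordW F a₀ ε₂₉ k (recordK₀ F Mc k + n)), InRegClass F Mc k ε₀ a₀ ε₂₉ n B) :
    Ψ.RepresentsW F a₀ ε₂₉ Mc k Ew Φf := by
  intro n
  filter_upwards [hnear n] with B hB
  exact h n B hB

variable {F} in
/-- **ε₀-class residue ⟹ germ residue** under the same near-`0` condition. [cite: Balaban1987RG1, (1.7) p.261, (1.18) p.263 (bookkeeping)] -/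
theorem residueAtW_of_onReg {Mc k : ℕ} {Ψ : IntLocalFormula (F.L ^ (k + 1) * Mc)} {Ew : TorusPieces F Mc k} {a₀ ε₂₉ α₀ α₁ ε₀ E₀ κ : ℝ}
    {Φf : (n : ℕ) → recordW F a₀ ε₂₉ k (recordK₀ F Mc k + n) → ℂ}
    (h : Ψ.ResidueOnRegAtW F Mc k Ew a₀ ε₂₉ α₀ α₁ ε₀ E₀ κ Φf)
    (hnear : ∀ n, letI θ := thetaFill F a₀ ε₂₉; letI := θ.instVβ₁; letI := θ.instVβ₂; letI := θ.instιβ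
      ∀ᶠ B in 𝓝 (0 : recordW F a₀ ε₂₉ k (recordK₀ F Mc k + n)), InRegClass F Mc k ε₀ a₀ ε₂₉ n B) :
    Ψ.ResidueAtW F Mc k Ew a₀ ε₂₉ α₀ α₁ E₀ κ Φf :=
  ⟨h.1, h.2.1, h.2.2.1, h.2.2.2.1, h.2.2.2.2.1, h.2.2.2.2.2.1, representsW_of_onReg h.2.2.2.2.2.2 hnear⟩

variable {F} in
/-- **The Uc edition implies the ε₀ edition GIVEN THE NESTING** `InRegClass … ε₀ ⇒ CutsInUc … α₀ α₁` at this level (print's «U_k(ε₀) ⊂ U^c_j(X, α₀, α₁) for ε₀ small», [I] p.263 L5–20 — an M-sized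
brick NOT proved here; this is its interface). [cite: Balaban1987RG1, p.263 L5–20] -/
theorem representsOnRegW_of_onUc_of_nesting {Ψ : IntFormula} {a₀ ε₂₉ : ℝ} {Mc k : ℕ} {α₀ α₁ ε₀ : ℝ} {Ew : TorusPieces F Mc k}
    {Φf : (n : ℕ) → recordW F a₀ ε₂₉ k (recordK₀ F Mc k + n) → ℂ}
    (h : Ψ.RepresentsOnUcW F a₀ ε₂₉ Mc k α₀ α₁ Ew Φf)
    (hnest : ∀ n (B : recordW F a₀ ε₂₉ k (recordK₀ F Mc k + n)), InRegClass F Mc k ε₀ a₀ ε₂₉ n B → CutsInUc F Mc k α₀ α₁ a₀ ε₂₉ n B) :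
    Ψ.RepresentsOnRegW F a₀ ε₂₉ Mc k ε₀ Ew Φf :=
  fun n B hB => h n B (hnest n B hB)

end Summit.QuantumFields.YangMills.Theorems.K0RecordFormatNames

namespace Summit.QuantumFields.YangMills.Theorems.BalabanUVNodesPortS1

open Summit.QuantumFields.YangMills.Theorems.K0RecordFormatNames
open Literature.MathematicalPhysics.QuantumFieldTheory.Balaban1983to89
open Literature.MathematicalPhysics.QuantumFieldTheory.Balaban1983to89.Node00
open Literature.MathematicalPhysics.QuantumFieldTheory.Balaban1983to89.T4Continuum (T4Family)
open _root_.Filter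

/-! ## §2  Per-level ε₀-class formats; the step letter; the LZ half -/

/-- **The LZ half's residue at ONE level, ε₀-class edition.** [cite: Balaban1987RG1, (1.4) p.260, (1.7) p.261, (1.18) p.263] -/
def LZResidueRegAt (F : T4Family) (Mc : ℕ) (a₀ ε₂₉ α₀ α₁ ε₀ E₁ κ : ℝ) (k : ℕ) : Prop :=
  ∃ (Ψ : IntLocalFormula (F.L ^ (k + 1) * Mc)) (Ew : TorusPieces F Mc k), Ψ.ResidueOnRegAtW F Mc k Ew a₀ ε₂₉ α₀ α₁ ε₀ E₁ κ (phiLZ F Mc a₀ ε₂₉ k)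

/-- **The FE half's residue at ONE level on the box, ε₀-class edition.** [cite: Balaban1987RG1, (2.12)–(2.13) p.268, (1.7) p.261, (1.18) p.263] -/
def FEResidueRegBoxAt (F : T4Family) (Mc : ℕ) (a₀ ε₂₉ γ₀ α₀ α₁ ε₀ E₂ κ : ℝ) (k : ℕ) : Prop :=
  ∀ v : Fin (k + 1) → ℝ, v ∈ FlowStep.Box γ₀ k →
    ∃ (Ψ : IntLocalFormula (F.L ^ (k + 1) * Mc)) (Ew : TorusPieces F Mc k), Ψ.ResidueOnRegAtW F Mc k Ew a₀ ε₂₉ α₀ α₁ ε₀ E₂ κ (phiFE F Mc a₀ ε₂₉ k v)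

/-- ★★ **`FEStepReg F` — PRINT's INDUCTIVE STEP ON PRINT's DOMAIN** (✓`FEStepBox` with `ResidueAtW ↦ ResidueOnRegAtW … ε₀`, the class radius `δ₀` of the LZ package and FE's `ε₀` displayed, both
positive and k-uniform): [I] Thm 3 at scale `k+1` from (1.7)+(1.18)+(1.19) at scales `≤ k` ON `U(ε₀)`.  OPEN (XXL); inhabited nowhere; a CANDIDATE letter.
[cite: Balaban1987RG1, Thm 3 p.264, p.268 L27–31, (1.7) p.261, (1.2) p.260, (2.12)–(2.14) p.268] -/
def FEStepReg (F : T4Family) : Prop :=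
  ∃ Mth : ℕ, ∀ Mc : ℕ, Mth ≤ Mc → ∀ (j c c₀ c₁ : ℕ) (B₃ B₃' a₀ a₁ : ℝ), Summit.QuantumFields.YangMills.Theorems.K0RecordFormatNames.McGuard F Mc → c ≤ F.L ^ j → c₀ ≤ j + 1 → c₁ ≤ j → 2 * (F.L : ℝ) ^ 2 ≤ B₃ → 0 < B₃' → 0 < a₀ → 0 < a₁ → Literature.MathematicalPhysics.QuantumFieldTheory.Balaban1983to89.Node00.VariationalThm1RegSepCoP7MGB F 2 (fun ν M g K k _s => c ≤ ν.M₁ ∧ k + c₀ ≤ F.m + K ∧ F.L ^ c₁ ∣ M ∧ ∀ i, 1 ≤ i → i ≤ k → Literature.MathematicalPhysics.QuantumFieldTheory.Balaban1983to89.Node00.dCubeSide (F.P K).L M (Literature.MathematicalPhysics.QuantumFieldTheory.Balaban1983to89.Node00.RkOfRecord (F.P K).L ν.r (g i)) i ∣ (F.P K).sitesPerDir 0) (Literature.MathematicalPhysics.QuantumFieldTheory.Balaban1983to89.Node00.lamDatum F) (Literature.MathematicalPhysics.QuantumFieldTheory.Balaban1983to89.Node00.dataSmall7LamTopOf F 2)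 B₃ a₀ a₁ → Literature.MathematicalPhysics.QuantumFieldTheory.Balaban1983to89.Node00.Gauge9RegSepTopStepGB F 2 (fun ν K Ω => Literature.MathematicalPhysics.QuantumFieldTheory.Balaban1983to89.Node00.suppDomOfRecord F ν K Ω) (F.L ^ j) (fun ν M g K k _s => c ≤ ν.M₁ ∧ k + c₀ ≤ F.m + K ∧ F.L ^ c₁ ∣ M ∧ ∀ i, 1 ≤ i → i ≤ k → Literature.MathematicalPhysics.QuantumFieldTheory.Balaban1983to89.Node00.dCubeSide (F.P K).L M (Literature.MathematicalPhysics.QuantumFieldTheory.Balaban1983to89.Node00.RkOfRecord (F.P K).L ν.r (g i)) i ∣ (F.P K).sitesPerDir 0) (Literature.MathematicalPhysics.QuantumFieldTheory.Balaban1983to89.Node00.lamDatum F) (Literature.MathematicalPhysics.QuantumFieldTheory.Balaban1983to89.Node00.dataSmall7LamTopOf F 2) B₃ B₃' a₀ a₁ → (∀ ε₁ : ℝ, 0 < ε₁ → ε₁ ≤ a₁ → B₃ * ε₁ ≤ a₀ → ∀ (k n : ℕ) (V : Literature.MathematicalPhysics.QuantumFieldTheory.Balaban1983to89.GaugeField (F.P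 (Summit.QuantumFields.YangMills.Theorems.K0RecordFormatNames.recordK₀ F Mc k + n)) (k + 1) (Literature.MathematicalPhysics.QuantumFieldTheory.Balaban1983to89.Node00.SU 2)), Literature.MathematicalPhysics.QuantumFieldTheory.Balaban1983to89.PlaqSmall ε₁ V → Literature.MathematicalPhysics.QuantumFieldTheory.Balaban1983to89.Node00.UkExists F 2 (Summit.QuantumFields.YangMills.Theorems.K0RecordFormatNames.recordK₀ F Mc k + n) (k + 1) a₀ V ∧ Literature.MathematicalPhysics.QuantumFieldTheory.Balaban1983to89.Node00.UniqueUkOrbit F 2 (Summit.QuantumFields.YangMills.Theorems.K0RecordFormatNames.recordK₀ F Mc k + n) (k + 1) a₀ V) → (∀ (k n : ℕ) (ε₂₉ : ℝ), 0 < ε₂₉ → letI θ := Summit.QuantumFields.YangMills.Theorems.K0RecordFormatNames.thetaFill F a₀ ε₂₉; letI := θ.instVβ₁; letI := θ.instVβ₂; letI := θ.instιβ; AnalyticAt ℝ (fun B : Summit.QuantumFields.YangMills.Theorems.K0RecordFormatNames.recordW F a₀ ε₂₉ k (Summit.QuantumFields.YangMills.Theorems.K0RecordFormatNames.recordK₀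 F Mc k + n) => fun (b : Literature.MathematicalPhysics.QuantumFieldTheory.Balaban1983to89.PBond (F.P (Summit.QuantumFields.YangMills.Theorems.K0RecordFormatNames.recordK₀ F Mc k + n)) 0) (i i' : Fin 2) => ((Summit.QuantumFields.YangMills.Theorems.K0RecordFormatNames.recordBgField F θ k (Summit.QuantumFields.YangMills.Theorems.K0RecordFormatNames.recordK₀ F Mc k + n) B b : Literature.MathematicalPhysics.QuantumFieldTheory.Balaban1983to89.Node00.SU 2) : Matrix (Fin 2) (Fin 2) ℂ) i i') 0) → (∃ C₉' δ₉ : ℝ, 0 ≤ C₉' ∧ 0 < δ₉ ∧ ∀ (k n : ℕ) (ε₂₉ : ℝ), 0 < ε₂₉ → letI θ := Summit.QuantumFields.YangMills.Theorems.K0RecordFormatNames.thetaFill F a₀ ε₂₉; letI := θ.instVβ₁; letI := θ.instVβ₂; letI := θ.instιβ; ∀ (a : θ.ιβ) (μ : Fin (F.P (Summit.QuantumFields.YangMills.Theorems.K0RecordFormatNames.recordK₀ F Mc k + n)).d) (y : Literature.MathematicalPhysics.QuantumFieldTheory.Balaban1983to89.Site (F.P (Summit.QuantumFields.YangMills.Theorems.K0RecordFormatNames.recordK₀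 F Mc k + n)) (k + 1)), letI D := fderiv ℝ (fun B : Summit.QuantumFields.YangMills.Theorems.K0RecordFormatNames.recordW F a₀ ε₂₉ k (Summit.QuantumFields.YangMills.Theorems.K0RecordFormatNames.recordK₀ F Mc k + n) => fun (b : Literature.MathematicalPhysics.QuantumFieldTheory.Balaban1983to89.PBond (F.P (Summit.QuantumFields.YangMills.Theorems.K0RecordFormatNames.recordK₀ F Mc k + n)) 0) (i i' : Fin 2) => ((Summit.QuantumFields.YangMills.Theorems.K0RecordFormatNames.recordBgField F θ k (Summit.QuantumFields.YangMills.Theorems.K0RecordFormatNames.recordK₀ F Mc k + n) B b : Literature.MathematicalPhysics.QuantumFieldTheory.Balaban1983to89.Node00.SU 2) : Matrix (Fin 2) (Fin 2) ℂ) i i') 0 (Pi.single μ (Pi.single y (θ.bV a))); ∃ (Hr : Literature.MathematicalPhysics.QuantumFieldTheory.Balaban1983to89.PBond (F.P (Summit.QuantumFields.YangMills.Theorems.K0RecordFormatNames.recordK₀ F Mc k + n)) 0 → Fin 2 → Fin 2 → ℂ) (φ : Literature.MathematicalPhysics.QuantumFieldTheory.Balaban1983to89.Site (F.P (Summit.QuantumFields.YangMills.Theorems.K0RecordFormatNames.recordK₀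 F Mc k + n)) 0 → Fin 2 → Fin 2 → ℂ), (∀ b : Literature.MathematicalPhysics.QuantumFieldTheory.Balaban1983to89.PBond (F.P (Summit.QuantumFields.YangMills.Theorems.K0RecordFormatNames.recordK₀ F Mc k + n)) 0, D b = Hr b + (φ b.src - φ (b.src.shift b.dir))) ∧ (∃ μc : Literature.MathematicalPhysics.QuantumFieldTheory.Balaban1983to89.Site (F.P (Summit.QuantumFields.YangMills.Theorems.K0RecordFormatNames.recordK₀ F Mc k + n)) (k + 1) → Fin 2 → Fin 2 → ℂ, ∀ x : Literature.MathematicalPhysics.QuantumFieldTheory.Balaban1983to89.Site (F.P (Summit.QuantumFields.YangMills.Theorems.K0RecordFormatNames.recordK₀ F Mc k + n)) 0, letI dv := (fun x' : Literature.MathematicalPhysics.QuantumFieldTheory.Balaban1983to89.Site (F.P (Summit.QuantumFields.YangMills.Theorems.K0RecordFormatNames.recordK₀ F Mc k + n)) 0 => ∑ ν : Fin (F.P (Summit.QuantumFields.YangMills.Theorems.K0RecordFormatNames.recordK₀ F Mc k + n)).d, (Hr ⟨x', ν⟩ - Hr ⟨x'.unshift ν, ν⟩)); ∑ ν : Fin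 (F.P (Summit.QuantumFields.YangMills.Theorems.K0RecordFormatNames.recordK₀ F Mc k + n)).d, (dv (x.shift ν) - (2 : ℂ) • dv x + dv (x.unshift ν)) = μc (Summit.QuantumFields.YangMills.Theorems.K0RecordFormatNames.coarsenTo (k + 1) x)) ∧ ∀ b : Literature.MathematicalPhysics.QuantumFieldTheory.Balaban1983to89.PBond (F.P (Summit.QuantumFields.YangMills.Theorems.K0RecordFormatNames.recordK₀ F Mc k + n)) 0, ‖Hr b‖ ≤ C₉' * (F.P (Summit.QuantumFields.YangMills.Theorems.K0RecordFormatNames.recordK₀ F Mc k + n)).eta (k + 1) * Real.exp (-(δ₉ * (Literature.MathematicalPhysics.QuantumFieldTheory.Balaban1983to89.Site.tdist (Summit.QuantumFields.YangMills.Theorems.K0RecordFormatNames.coarsenTo (k + 1) b.src) y : ℝ))) ∧ (∀ ν : Fin (F.P (Summit.QuantumFields.YangMills.Theorems.K0RecordFormatNames.recordK₀ F Mc k + n)).d, ‖Hr (⟨b.src.shift ν, b.dir⟩ : Literature.MathematicalPhysics.QuantumFieldTheory.Balaban1983to89.PBond (F.P (Summit.QuantumFields.YangMills.Theorems.K0RecordFormatNames.recordK₀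 F Mc k + n)) 0) - Hr b‖ ≤ C₉' * (F.P (Summit.QuantumFields.YangMills.Theorems.K0RecordFormatNames.recordK₀ F Mc k + n)).eta (k + 1) ^ 2 * Real.exp (-(δ₉ * (Literature.MathematicalPhysics.QuantumFieldTheory.Balaban1983to89.Site.tdist (Summit.QuantumFields.YangMills.Theorems.K0RecordFormatNames.coarsenTo (k + 1) b.src) y : ℝ)))) ∧ ‖∑ ν : Fin (F.P (Summit.QuantumFields.YangMills.Theorems.K0RecordFormatNames.recordK₀ F Mc k + n)).d, (Hr (⟨b.src.shift ν, b.dir⟩ : Literature.MathematicalPhysics.QuantumFieldTheory.Balaban1983to89.PBond (F.P (Summit.QuantumFields.YangMills.Theorems.K0RecordFormatNames.recordK₀ F Mc k + n)) 0) - (2 : ℂ) • Hr b + Hr (⟨b.src.unshift ν, b.dir⟩ : Literature.MathematicalPhysics.QuantumFieldTheory.Balaban1983to89.PBond (F.P (Summit.QuantumFields.YangMills.Theorems.K0RecordFormatNames.recordK₀ F Mc k + n)) 0))‖ ≤ C₉' * (F.P (Summit.QuantumFields.YangMills.Theorems.K0RecordFormatNames.recordK₀ F Mc k + n)).eta (k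 + 1) ^ 3 * Real.exp (-(δ₉ * (Literature.MathematicalPhysics.QuantumFieldTheory.Balaban1983to89.Site.tdist (Summit.QuantumFields.YangMills.Theorems.K0RecordFormatNames.coarsenTo (k + 1) b.src) y : ℝ))) ∧ ‖∑ ν : Fin (F.P (Summit.QuantumFields.YangMills.Theorems.K0RecordFormatNames.recordK₀ F Mc k + n)).d, ((Hr (⟨b.src, b.dir⟩ : Literature.MathematicalPhysics.QuantumFieldTheory.Balaban1983to89.PBond (F.P (Summit.QuantumFields.YangMills.Theorems.K0RecordFormatNames.recordK₀ F Mc k + n)) 0) + Hr (⟨(b.src).shift b.dir, ν⟩ : Literature.MathematicalPhysics.QuantumFieldTheory.Balaban1983to89.PBond (F.P (Summit.QuantumFields.YangMills.Theorems.K0RecordFormatNames.recordK₀ F Mc k + n)) 0) - Hr (⟨(b.src).shift ν, b.dir⟩ : Literature.MathematicalPhysics.QuantumFieldTheory.Balaban1983to89.PBond (F.P (Summit.QuantumFields.YangMills.Theorems.K0RecordFormatNames.recordK₀ F Mc k + n)) 0) - Hr (⟨b.src, ν⟩ : Literature.MathematicalPhysics.QuantumFieldTheory.Balaban1983to89.PBond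 (F.P (Summit.QuantumFields.YangMills.Theorems.K0RecordFormatNames.recordK₀ F Mc k + n)) 0)) - (Hr (⟨b.src.unshift ν, b.dir⟩ : Literature.MathematicalPhysics.QuantumFieldTheory.Balaban1983to89.PBond (F.P (Summit.QuantumFields.YangMills.Theorems.K0RecordFormatNames.recordK₀ F Mc k + n)) 0) + Hr (⟨(b.src.unshift ν).shift b.dir, ν⟩ : Literature.MathematicalPhysics.QuantumFieldTheory.Balaban1983to89.PBond (F.P (Summit.QuantumFields.YangMills.Theorems.K0RecordFormatNames.recordK₀ F Mc k + n)) 0) - Hr (⟨(b.src.unshift ν).shift ν, b.dir⟩ : Literature.MathematicalPhysics.QuantumFieldTheory.Balaban1983to89.PBond (F.P (Summit.QuantumFields.YangMills.Theorems.K0RecordFormatNames.recordK₀ F Mc k + n)) 0) - Hr (⟨b.src.unshift ν, ν⟩ : Literature.MathematicalPhysics.QuantumFieldTheory.Balaban1983to89.PBond (F.P (Summit.QuantumFields.YangMills.Theorems.K0RecordFormatNames.recordK₀ F Mc k + n)) 0)))‖ ≤ C₉' * (F.P (Summit.QuantumFields.YangMills.Theorems.K0RecordFormatNames.recordK₀ F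 Mc k + n)).eta (k + 1) ^ 3 * Real.exp (-(δ₉ * (Literature.MathematicalPhysics.QuantumFieldTheory.Balaban1983to89.Site.tdist (Summit.QuantumFields.YangMills.Theorems.K0RecordFormatNames.coarsenTo (k + 1) b.src) y : ℝ)))) → ∃ ε₂₉ : ℝ, 0 < ε₂₉ ∧ ∀ (E₁ κ₁ β₀ β₁ δ₀ : ℝ), 0 ≤ E₁ → 4 * Literature.MathematicalPhysics.QuantumFieldTheory.Balaban1983to89.B12TreeDecay.kappa₀ (4 * 2 ^ 4) (2 * 4) ≤ κ₁ → 0 < β₀ → 0 < β₁ → 0 < δ₀ → (∀ k : ℕ, Summit.QuantumFields.YangMills.Theorems.BalabanUVNodesPortS1.LZResidueRegAt F Mc a₀ ε₂₉ β₀ β₁ δ₀ E₁ κ₁ k) → ∃ γ₀ E₂ κ α₀ α₁ ε₀ : ℝ, 0 < γ₀ ∧ 0 ≤ E₂ ∧ 4 * Literature.MathematicalPhysics.QuantumFieldTheory.Balaban1983to89.B12TreeDecay.kappa₀ (4 * 2 ^ 4) (2 * 4) ≤ κ ∧ 0 < α₀ ∧ 0 < α₁ ∧ 0 < ε₀ ∧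 ∀ k : ℕ, (∀ j : ℕ, j < k → Summit.QuantumFields.YangMills.Theorems.BalabanUVNodesPortS1.FEResidueRegBoxAt F Mc a₀ ε₂₉ γ₀ α₀ α₁ ε₀ E₂ κ j) → Summit.QuantumFields.YangMills.Theorems.BalabanUVNodesPortS1.FEResidueRegBoxAt F Mc a₀ ε₂₉ γ₀ α₀ α₁ ε₀ E₂ κ k

/-- **`PortRecordLZHalfReg F` — the LZ half, ε₀-class edition.**  OPEN as a letter (the landed LZ files give the germ; the class edition needs the P0-ℂ letter's (P2) row on the class — located, P0-class).
[cite: Balaban1987RG1, (1.4) p.260, (1.7) p.261, (1.2) p.260; Balaban1985UV3, (63) p.272] -/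
def PortRecordLZHalfReg (F : T4Family) : Prop :=
  ∃ Mth : ℕ, ∀ Mc : ℕ, Mth ≤ Mc → ∀ (j c c₀ c₁ : ℕ) (B₃ B₃' a₀ a₁ : ℝ), Summit.QuantumFields.YangMills.Theorems.K0RecordFormatNames.McGuard F Mc → c ≤ F.L ^ j → c₀ ≤ j + 1 → c₁ ≤ j → 2 * (F.L : ℝ) ^ 2 ≤ B₃ → 0 < B₃' → 0 < a₀ → 0 < a₁ → Literature.MathematicalPhysics.QuantumFieldTheory.Balaban1983to89.Node00.VariationalThm1RegSepCoP7MGB F 2 (fun ν M g K k _s => c ≤ ν.M₁ ∧ k + c₀ ≤ F.m + K ∧ F.L ^ c₁ ∣ M ∧ ∀ i, 1 ≤ i → i ≤ k → Literature.MathematicalPhysics.QuantumFieldTheory.Balaban1983to89.Node00.dCubeSide (F.P K).L M (Literature.MathematicalPhysics.QuantumFieldTheory.Balaban1983to89.Node00.RkOfRecord (F.P K).L ν.r (g i)) i ∣ (F.P K).sitesPerDir 0) (Literature.MathematicalPhysics.QuantumFieldTheory.Balaban1983to89.Node00.lamDatum F) (Literature.MathematicalPhysics.QuantumFieldTheory.Balaban1983to89.Node00.dataSmall7LamTopOf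 F 2) B₃ a₀ a₁ → Literature.MathematicalPhysics.QuantumFieldTheory.Balaban1983to89.Node00.Gauge9RegSepTopStepGB F 2 (fun ν K Ω => Literature.MathematicalPhysics.QuantumFieldTheory.Balaban1983to89.Node00.suppDomOfRecord F ν K Ω) (F.L ^ j) (fun ν M g K k _s => c ≤ ν.M₁ ∧ k + c₀ ≤ F.m + K ∧ F.L ^ c₁ ∣ M ∧ ∀ i, 1 ≤ i → i ≤ k → Literature.MathematicalPhysics.QuantumFieldTheory.Balaban1983to89.Node00.dCubeSide (F.P K).L M (Literature.MathematicalPhysics.QuantumFieldTheory.Balaban1983to89.Node00.RkOfRecord (F.P K).L ν.r (g i)) i ∣ (F.P K).sitesPerDir 0) (Literature.MathematicalPhysics.QuantumFieldTheory.Balaban1983to89.Node00.lamDatum F) (Literature.MathematicalPhysics.QuantumFieldTheory.Balaban1983to89.Node00.dataSmall7LamTopOf F 2) B₃ B₃' a₀ a₁ → (∀ ε₁ : ℝ, 0 < ε₁ → ε₁ ≤ a₁ → B₃ * ε₁ ≤ a₀ → ∀ (k n : ℕ) (V : Literature.MathematicalPhysics.QuantumFieldTheory.Balaban1983to89.GaugeField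 (F.P (Summit.QuantumFields.YangMills.Theorems.K0RecordFormatNames.recordK₀ F Mc k + n)) (k + 1) (Literature.MathematicalPhysics.QuantumFieldTheory.Balaban1983to89.Node00.SU 2)), Literature.MathematicalPhysics.QuantumFieldTheory.Balaban1983to89.PlaqSmall ε₁ V → Literature.MathematicalPhysics.QuantumFieldTheory.Balaban1983to89.Node00.UkExists F 2 (Summit.QuantumFields.YangMills.Theorems.K0RecordFormatNames.recordK₀ F Mc k + n) (k + 1) a₀ V ∧ Literature.MathematicalPhysics.QuantumFieldTheory.Balaban1983to89.Node00.UniqueUkOrbit F 2 (Summit.QuantumFields.YangMills.Theorems.K0RecordFormatNames.recordK₀ F Mc k + n) (k + 1) a₀ V) → (∀ (k n : ℕ) (ε₂₉ : ℝ), 0 < ε₂₉ → letI θ := Summit.QuantumFields.YangMills.Theorems.K0RecordFormatNames.thetaFill F a₀ ε₂₉; letI := θ.instVβ₁; letI := θ.instVβ₂; letI := θ.instιβ; AnalyticAt ℝ (fun B : Summit.QuantumFields.YangMills.Theorems.K0RecordFormatNames.recordW F a₀ ε₂₉ k (Summit.QuantumFields.YangMills.Theorems.K0RecordFormatNames.recordK₀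 F Mc k + n) => fun (b : Literature.MathematicalPhysics.QuantumFieldTheory.Balaban1983to89.PBond (F.P (Summit.QuantumFields.YangMills.Theorems.K0RecordFormatNames.recordK₀ F Mc k + n)) 0) (i i' : Fin 2) => ((Summit.QuantumFields.YangMills.Theorems.K0RecordFormatNames.recordBgField F θ k (Summit.QuantumFields.YangMills.Theorems.K0RecordFormatNames.recordK₀ F Mc k + n) B b : Literature.MathematicalPhysics.QuantumFieldTheory.Balaban1983to89.Node00.SU 2) : Matrix (Fin 2) (Fin 2) ℂ) i i') 0) → (∃ C₉' δ₉ : ℝ, 0 ≤ C₉' ∧ 0 < δ₉ ∧ ∀ (k n : ℕ) (ε₂₉ : ℝ), 0 < ε₂₉ → letI θ := Summit.QuantumFields.YangMills.Theorems.K0RecordFormatNames.thetaFill F a₀ ε₂₉; letI := θ.instVβ₁; letI := θ.instVβ₂; letI := θ.instιβ; ∀ (a : θ.ιβ) (μ : Fin (F.P (Summit.QuantumFields.YangMills.Theorems.K0RecordFormatNames.recordK₀ F Mc k + n)).d) (y : Literature.MathematicalPhysics.QuantumFieldTheory.Balaban1983to89.Site (F.P (Summit.QuantumFields.YangMills.Theorems.K0RecordFormatNames.recordK₀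 F Mc k + n)) (k + 1)), letI D := fderiv ℝ (fun B : Summit.QuantumFields.YangMills.Theorems.K0RecordFormatNames.recordW F a₀ ε₂₉ k (Summit.QuantumFields.YangMills.Theorems.K0RecordFormatNames.recordK₀ F Mc k + n) => fun (b : Literature.MathematicalPhysics.QuantumFieldTheory.Balaban1983to89.PBond (F.P (Summit.QuantumFields.YangMills.Theorems.K0RecordFormatNames.recordK₀ F Mc k + n)) 0) (i i' : Fin 2) => ((Summit.QuantumFields.YangMills.Theorems.K0RecordFormatNames.recordBgField F θ k (Summit.QuantumFields.YangMills.Theorems.K0RecordFormatNames.recordK₀ F Mc k + n) B b : Literature.MathematicalPhysics.QuantumFieldTheory.Balaban1983to89.Node00.SU 2) : Matrix (Fin 2) (Fin 2) ℂ) i i') 0 (Pi.single μ (Pi.single y (θ.bV a))); ∃ (Hr : Literature.MathematicalPhysics.QuantumFieldTheory.Balaban1983to89.PBond (F.P (Summit.QuantumFields.YangMills.Theorems.K0RecordFormatNames.recordK₀ F Mc k + n)) 0 → Fin 2 → Fin 2 → ℂ) (φ : Literature.MathematicalPhysics.QuantumFieldTheory.Balaban1983to89.Site (F.P (Summit.QuantumFields.YangMills.Theorems.K0RecordFormatNames.recordK₀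 F Mc k + n)) 0 → Fin 2 → Fin 2 → ℂ), (∀ b : Literature.MathematicalPhysics.QuantumFieldTheory.Balaban1983to89.PBond (F.P (Summit.QuantumFields.YangMills.Theorems.K0RecordFormatNames.recordK₀ F Mc k + n)) 0, D b = Hr b + (φ b.src - φ (b.src.shift b.dir))) ∧ (∃ μc : Literature.MathematicalPhysics.QuantumFieldTheory.Balaban1983to89.Site (F.P (Summit.QuantumFields.YangMills.Theorems.K0RecordFormatNames.recordK₀ F Mc k + n)) (k + 1) → Fin 2 → Fin 2 → ℂ, ∀ x : Literature.MathematicalPhysics.QuantumFieldTheory.Balaban1983to89.Site (F.P (Summit.QuantumFields.YangMills.Theorems.K0RecordFormatNames.recordK₀ F Mc k + n)) 0, letI dv := (fun x' : Literature.MathematicalPhysics.QuantumFieldTheory.Balaban1983to89.Site (F.P (Summit.QuantumFields.YangMills.Theorems.K0RecordFormatNames.recordK₀ F Mc k + n)) 0 => ∑ ν : Fin (F.P (Summit.QuantumFields.YangMills.Theorems.K0RecordFormatNames.recordK₀ F Mc k + n)).d, (Hr ⟨x', ν⟩ - Hr ⟨x'.unshift ν, ν⟩)); ∑ ν : Fin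 (F.P (Summit.QuantumFields.YangMills.Theorems.K0RecordFormatNames.recordK₀ F Mc k + n)).d, (dv (x.shift ν) - (2 : ℂ) • dv x + dv (x.unshift ν)) = μc (Summit.QuantumFields.YangMills.Theorems.K0RecordFormatNames.coarsenTo (k + 1) x)) ∧ ∀ b : Literature.MathematicalPhysics.QuantumFieldTheory.Balaban1983to89.PBond (F.P (Summit.QuantumFields.YangMills.Theorems.K0RecordFormatNames.recordK₀ F Mc k + n)) 0, ‖Hr b‖ ≤ C₉' * (F.P (Summit.QuantumFields.YangMills.Theorems.K0RecordFormatNames.recordK₀ F Mc k + n)).eta (k + 1) * Real.exp (-(δ₉ * (Literature.MathematicalPhysics.QuantumFieldTheory.Balaban1983to89.Site.tdist (Summit.QuantumFields.YangMills.Theorems.K0RecordFormatNames.coarsenTo (k + 1) b.src) y : ℝ))) ∧ (∀ ν : Fin (F.P (Summit.QuantumFields.YangMills.Theorems.K0RecordFormatNames.recordK₀ F Mc k + n)).d, ‖Hr (⟨b.src.shift ν, b.dir⟩ : Literature.MathematicalPhysics.QuantumFieldTheory.Balaban1983to89.PBond (F.P (Summit.QuantumFields.YangMills.Theorems.K0RecordFormatNames.recordK₀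 F Mc k + n)) 0) - Hr b‖ ≤ C₉' * (F.P (Summit.QuantumFields.YangMills.Theorems.K0RecordFormatNames.recordK₀ F Mc k + n)).eta (k + 1) ^ 2 * Real.exp (-(δ₉ * (Literature.MathematicalPhysics.QuantumFieldTheory.Balaban1983to89.Site.tdist (Summit.QuantumFields.YangMills.Theorems.K0RecordFormatNames.coarsenTo (k + 1) b.src) y : ℝ)))) ∧ ‖∑ ν : Fin (F.P (Summit.QuantumFields.YangMills.Theorems.K0RecordFormatNames.recordK₀ F Mc k + n)).d, (Hr (⟨b.src.shift ν, b.dir⟩ : Literature.MathematicalPhysics.QuantumFieldTheory.Balaban1983to89.PBond (F.P (Summit.QuantumFields.YangMills.Theorems.K0RecordFormatNames.recordK₀ F Mc k + n)) 0) - (2 : ℂ) • Hr b + Hr (⟨b.src.unshift ν, b.dir⟩ : Literature.MathematicalPhysics.QuantumFieldTheory.Balaban1983to89.PBond (F.P (Summit.QuantumFields.YangMills.Theorems.K0RecordFormatNames.recordK₀ F Mc k + n)) 0))‖ ≤ C₉' * (F.P (Summit.QuantumFields.YangMills.Theorems.K0RecordFormatNames.recordK₀ F Mc k + n)).eta (k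 + 1) ^ 3 * Real.exp (-(δ₉ * (Literature.MathematicalPhysics.QuantumFieldTheory.Balaban1983to89.Site.tdist (Summit.QuantumFields.YangMills.Theorems.K0RecordFormatNames.coarsenTo (k + 1) b.src) y : ℝ))) ∧ ‖∑ ν : Fin (F.P (Summit.QuantumFields.YangMills.Theorems.K0RecordFormatNames.recordK₀ F Mc k + n)).d, ((Hr (⟨b.src, b.dir⟩ : Literature.MathematicalPhysics.QuantumFieldTheory.Balaban1983to89.PBond (F.P (Summit.QuantumFields.YangMills.Theorems.K0RecordFormatNames.recordK₀ F Mc k + n)) 0) + Hr (⟨(b.src).shift b.dir, ν⟩ : Literature.MathematicalPhysics.QuantumFieldTheory.Balaban1983to89.PBond (F.P (Summit.QuantumFields.YangMills.Theorems.K0RecordFormatNames.recordK₀ F Mc k + n)) 0) - Hr (⟨(b.src).shift ν, b.dir⟩ : Literature.MathematicalPhysics.QuantumFieldTheory.Balaban1983to89.PBond (F.P (Summit.QuantumFields.YangMills.Theorems.K0RecordFormatNames.recordK₀ F Mc k + n)) 0) - Hr (⟨b.src, ν⟩ : Literature.MathematicalPhysics.QuantumFieldTheory.Balaban1983to89.PBond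 (F.P (Summit.QuantumFields.YangMills.Theorems.K0RecordFormatNames.recordK₀ F Mc k + n)) 0)) - (Hr (⟨b.src.unshift ν, b.dir⟩ : Literature.MathematicalPhysics.QuantumFieldTheory.Balaban1983to89.PBond (F.P (Summit.QuantumFields.YangMills.Theorems.K0RecordFormatNames.recordK₀ F Mc k + n)) 0) + Hr (⟨(b.src.unshift ν).shift b.dir, ν⟩ : Literature.MathematicalPhysics.QuantumFieldTheory.Balaban1983to89.PBond (F.P (Summit.QuantumFields.YangMills.Theorems.K0RecordFormatNames.recordK₀ F Mc k + n)) 0) - Hr (⟨(b.src.unshift ν).shift ν, b.dir⟩ : Literature.MathematicalPhysics.QuantumFieldTheory.Balaban1983to89.PBond (F.P (Summit.QuantumFields.YangMills.Theorems.K0RecordFormatNames.recordK₀ F Mc k + n)) 0) - Hr (⟨b.src.unshift ν, ν⟩ : Literature.MathematicalPhysics.QuantumFieldTheory.Balaban1983to89.PBond (F.P (Summit.QuantumFields.YangMills.Theorems.K0RecordFormatNames.recordK₀ F Mc k + n)) 0)))‖ ≤ C₉' * (F.P (Summit.QuantumFields.YangMills.Theorems.K0RecordFormatNames.recordK₀ F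 Mc k + n)).eta (k + 1) ^ 3 * Real.exp (-(δ₉ * (Literature.MathematicalPhysics.QuantumFieldTheory.Balaban1983to89.Site.tdist (Summit.QuantumFields.YangMills.Theorems.K0RecordFormatNames.coarsenTo (k + 1) b.src) y : ℝ)))) → ∀ ε₂₉ : ℝ, 0 < ε₂₉ → ∃ E₁ κ α₀ α₁ δ₀ : ℝ, 0 ≤ E₁ ∧ 4 * Literature.MathematicalPhysics.QuantumFieldTheory.Balaban1983to89.B12TreeDecay.kappa₀ (4 * 2 ^ 4) (2 * 4) ≤ κ ∧ 0 < α₀ ∧ 0 < α₁ ∧ 0 < δ₀ ∧ ∀ k : ℕ, Summit.QuantumFields.YangMills.Theorems.BalabanUVNodesPortS1.LZResidueRegAt F Mc a₀ ε₂₉ α₀ α₁ δ₀ E₁ κ k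

/-! ## §3  Near `B = 0` the charted datum is ε₀-regular (a theorem); strong induction; the germ edition from the two ε₀-letters -/

/-- **All FE residues (ε₀ edition) from the step** — strong induction on `k`. [cite: Balaban1987RG1, p.268 L27–31, Thm 3 p.264] -/
theorem feResidueRegBoxAt_all_of_step {F : T4Family} {Mc : ℕ} {a₀ ε₂₉ γ₀ α₀ α₁ ε₀ E₂ κ : ℝ}
    (hstep : ∀ k : ℕ, (∀ j : ℕ, j < k → FEResidueRegBoxAt F Mc a₀ ε₂₉ γ₀ α₀ α₁ ε₀ E₂ κ j) → FEResidueRegBoxAt F Mc a₀ ε₂₉ γ₀ α₀ α₁ ε₀ E₂ κ k) :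
    ∀ k : ℕ, FEResidueRegBoxAt F Mc a₀ ε₂₉ γ₀ α₀ α₁ ε₀ E₂ κ k :=
  fun k => Nat.strong_induction_on k fun n ih => hstep n ih

/-- **ε₀ edition ⟹ germ, FE format at one level**, given near-`0` regularity at that level. [cite: Balaban1987RG1, (1.7) p.261 (bookkeeping)] -/
theorem feResidueBoxAt_of_reg {F : T4Family} {Mc : ℕ} {a₀ ε₂₉ γ₀ α₀ α₁ ε₀ E₂ κ : ℝ} {k : ℕ}
    (h : FEResidueRegBoxAt F Mc a₀ ε₂₉ γ₀ α₀ α₁ ε₀ E₂ κ k)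
    (hnear : ∀ n, letI θ := thetaFill F a₀ ε₂₉; letI := θ.instVβ₁; letI := θ.instVβ₂; letI := θ.instιβ
      ∀ᶠ B in 𝓝 (0 : recordW F a₀ ε₂₉ k (recordK₀ F Mc k + n)), InRegClass F Mc k ε₀ a₀ ε₂₉ n B) :
    FEResidueBoxAt F Mc a₀ ε₂₉ γ₀ α₀ α₁ E₂ κ k := by
  intro v hv
  obtain ⟨Ψ, Ew, hR⟩ := h v hv
  exact ⟨Ψ, Ew, residueAtW_of_onReg hR hnear⟩

/-- **The plaquette deviation of the rooted background, read two ways**: `dist1 (U_{k+1}(W_B)(∂p)) = ‖𝐔(∂p) − 1‖` for the units-valued reading `recordBgUnits = ιSU ∘ recordBgField` (the monoid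
morphism `ιSU` maps the printed plaquette word to the printed plaquette word). [cite: Balaban1987RG1, (1.11) p.262, (1.2) p.260 (bookkeeping)] -/
theorem dist1_plaqHol_recordBgField_eq (F : T4Family) (θ : Stage13Params F 2) (k K : ℕ) (B : Fin (F.P K).d → Site (F.P K) (k + 1) → θ.Vβ) (p : Plaq (F.P K) 0) :
    dist1 (GaugeField.plaqHol (recordBgField F θ k K B) p) =
      ‖((B12RegularSpaces111.plaq (recordBgUnits F θ k K B) p : (MatA 2)ˣ) : MatA 2) - 1‖ := by
  have key : B12RegularSpaces111.plaq (recordBgUnits F θ k K B) p = ιSU 2 (GaugeField.plaqHol (recordBgField F θ k K B) p) := by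
    rw [B12RegularSpaces111.plaq_eq]
    unfold GaugeField.plaqHol recordBgUnits
    simp only [map_mul, map_inv]
  rw [key, coe_ιSU]
  rfl

/-- ★★ **NEAR `B = 0` THE CHARTED DATUM IS ε₀-REGULAR, for every `ε₀ > 0`** (plaquette variables of `U_{k+1}(W_B)` tend to `1` — ✓`eventually_norm_plaq_recordBgUnits_sub_one_lt` from the antecedent's
analyticity row `hP9` at `(k, n, ε₂₉)`). [cite: Balaban1987RG1, (1.2) p.260, (1.11) p.262; Balaban1985Variational, Prop. 9 p.309] -/
theorem eventually_inRegClass (F : T4Family) (a₀ ε₂₉ : ℝ) (Mc k n : ℕ)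
    (hP9 : letI θ := thetaFill F a₀ ε₂₉; letI := θ.instVβ₁; letI := θ.instVβ₂; letI := θ.instιβ
      AnalyticAt ℝ (fun B : recordW F a₀ ε₂₉ k (recordK₀ F Mc k + n) => fun (b : PBond (F.P (recordK₀ F Mc k + n)) 0) (i i' : Fin 2) =>
        ((recordBgField F θ k (recordK₀ F Mc k + n) B b : SU 2) : Matrix (Fin 2) (Fin 2) ℂ) i i') 0)
    {ε₁ : ℝ} (hε₁ : 0 < ε₁)
    (hUk : ∀ V : GaugeField (F.P (recordK₀ F Mc k + n)) (k + 1) (SU 2), PlaqSmall ε₁ V →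
      UkExists F 2 (recordK₀ F Mc k + n) (k + 1) a₀ V ∧ UniqueUkOrbit F 2 (recordK₀ F Mc k + n) (k + 1) a₀ V)
    {ε₀ : ℝ} (hε₀ : 0 < ε₀) :
    letI θ := thetaFill F a₀ ε₂₉; letI := θ.instVβ₁; letI := θ.instVβ₂; letI := θ.instιβ
    ∀ᶠ B in 𝓝 (0 : recordW F a₀ ε₂₉ k (recordK₀ F Mc k + n)), InRegClass F Mc k ε₀ a₀ ε₂₉ n B := by
  letI θ := thetaFill F a₀ ε₂₉; letI := θ.instVβ₁; letI := θ.instVβ₂; letI := θ.instιβ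
  set K := recordK₀ F Mc k + n with hKdef
  have hk : k + 1 ≤ (F.P K).m + (F.P K).K := succ_le_m_add_K_recordK₀ F Mc k n
  have hξ : 0 < (F.P K).eta (k + 1) := pow_pos (inv_pos.mpr (Nat.cast_pos.mpr (F.P K).L_pos)) _
  have hγ : 0 < ε₀ * (F.P K).eta (k + 1) ^ 2 := by positivity
  filter_upwards [eventually_norm_plaq_recordBgUnits_sub_one_lt F θ hk hP9 hγ, eventually_plaqSmall_unitField F a₀ ε₂₉ k K hε₁] with B hB hW
  refine ⟨?_, ?_⟩
  · show UkExists F 2 K (k + 1) a₀ (unitField F θ k K B)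
    exact (hUk _ hW).1
  · show PlaqSmall (ε₀ * (F.P K).eta (k + 1) ^ 2) (recordBgField F θ k K B)
    intro p
    rw [dist1_plaqHol_recordBgField_eq F]
    exact hB p

/-- ★★★ **`PortRecordFEHalfBox` (v3.5's stub type; ⟹ v3.6's `FEStepBox` by ✓`feStepBox_of_feHalfBox`) FROM THE TWO ε₀-CLASS LETTERS** {LZ half (Reg), FE inductive step (Reg)} — the near-`0`
regularity being the theorem `eventually_inRegClass`.  CONDITIONAL bookkeeping; both letters OPEN. [cite: Balaban1987RG1, Thm 3 p.264, p.268 L27–31, (1.7) p.261, (1.2) p.260] -/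
theorem portRecordFEHalfBox_of_reg (hLZ : ∀ F, PortRecordLZHalfReg F) (hS : ∀ F, FEStepReg F) :
    ∀ F, Summit.QuantumFields.YangMills.Theorems.BalabanUVNodesPortS1.PortRecordFEHalfBox F := by
  intro F
  obtain ⟨M₁, H₁⟩ := hLZ F
  obtain ⟨M₂, H₂⟩ := hS F
  refine ⟨max M₁ M₂, fun Mc hMc j c c₀ c₁ B₃ B₃' a₀ a₁ hG h₁ h₂ h₃ h₄ h₅ h₆ h₇ hT8 hT9 hTE hP9 hP9L => ?_⟩
  obtain ⟨ε₂₉, hε, HS⟩ := H₂ Mc (le_of_max_le_right hMc) j c c₀ c₁ B₃ B₃' a₀ a₁ hG h₁ h₂ h₃ h₄ h₅ h₆ h₇ hT8 hT9 hTE hP9 hP9L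
  obtain ⟨E₁, κ₁, β₀, β₁, δ₀, hE₁, hκ₁, hβ₀, hβ₁, hδ₀, HLZ⟩ :=
    H₁ Mc (le_of_max_le_left hMc) j c c₀ c₁ B₃ B₃' a₀ a₁ hG h₁ h₂ h₃ h₄ h₅ h₆ h₇ hT8 hT9 hTE hP9 hP9L ε₂₉ hε
  obtain ⟨γ₀, E₂, κ, α₀, α₁, ε₀, hγ, hE₂, hκ, hα₀, hα₁, hε₀, Hstep⟩ := HS E₁ κ₁ β₀ β₁ δ₀ hE₁ hκ₁ hβ₀ hβ₁ hδ₀ HLZ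
  -- the antecedent's [15] Thm 1 token at one admissible radius `ε₁ := min a₁ (a₀ ∕ B₃)` (`0 < ε₁ ≤ a₁`, `B₃ε₁ ≤ a₀`; `B₃ ≥ 2L² > 0`)
  have hL1 : (1 : ℝ) ≤ (F.L : ℝ) := by exact_mod_cast F.hL.2.le
  have hB₃ : 0 < B₃ := lt_of_lt_of_le (by positivity : (0 : ℝ) < 2 * (F.L : ℝ) ^ 2) h₄
  have hε₁ : 0 < min a₁ (a₀ / B₃) := lt_min h₇ (div_pos h₆ hB₃)
  have hUk := hTE (min a₁ (a₀ / B₃)) hε₁ (min_le_left _ _)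
    (by rw [← le_div_iff₀' hB₃]; exact min_le_right _ _)
  refine ⟨γ₀, ε₂₉, E₂, κ, α₀, α₁, hγ, hε, hE₂, hκ, hα₀, hα₁, fun k v hv => ?_⟩
  exact feResidueBoxAt_of_reg (feResidueRegBoxAt_all_of_step Hstep k)
    (fun n => eventually_inRegClass F a₀ ε₂₉ Mc k n (hP9 k n ε₂₉ hε) hε₁ (hUk k n) hε₀) v hv

-- standard axioms only
#print axioms eventually_inRegClass
#print axioms portRecordFEHalfBox_of_reg

end Summit.QuantumFields.YangMills.Theorems.BalabanUVNodesPortS1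

end
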